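import Summits.AnomalousDissipation.AnomalousDissipation.Theorems.SawtoothPulseCascadeK1LocalisedCascadeFibreWindow

/-!
# K1loc, line `Spectral` / thin start — helper: TRIGONOMETRIC-POLYNOMIAL KERNELS ON THE CIRCLE, UNIFORM `L¹` BOUNDS (S-D step)

Helper file of the prover lane on the crux `K1LocalisedCascade` (stmt-AnomalousDissipation-19491), route
`SawtoothPulseCascade` (S-D fibre ledger, brick B-K).  The window lemma `…FibreWindow.sum_window_sq_norm_comp_shearMap_le`
consumes two smooth LATTICE CUT-OFFS along one axis — the input split `θ₁ = χ(D_j)θ` and the mid-band part of the chirp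
`g^mid = ψ(D)g` — through physical-space bounds of their kernels.  For a finitely supported symbol `χ : ℤ → ℂ` the kernel is
the trigonometric polynomial `k_χ(s) = Σ_m χ(m) e_{−m}(s)` on `T = ℝ/ℤ`; this file proves the elementary, EXPLICIT and
scale-uniform bounds
* `integral_norm_sq_trigPoly` — finite Parseval `∫|k_χ|² = Σ|χ(m)|²`;
* `fourier_one_sub_one_mul_trigPoly` — the difference identity `(e₁(s) − 1)·k_χ(s) = k_{Δχ}(s)`, `Δχ(m) = χ(m+1) − χ(m)`;
* `four_mul_norm_le_norm_fourier_one_sub_one` — `4‖s‖ ≤ |e₁(s) − 1|` (`|e^{2πix} − 1| = 2|sin πx| ≥ 4|x|` on `|x| ≤ ½`);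
* `integral_inv_one_add_sq_norm_le` — `∫_T (1 + Λ²‖s‖²)⁻¹ ds ≤ π/Λ`;
* `integral_norm_trigPoly_le` — **`∫_T |k_χ| ≤ √(π/Λ) · √(Σ|χ|² + (Λ²/16)·Σ|Δχ|²)`** for every `Λ > 0` (Cauchy–Schwarz against
  the weight `1 + Λ²‖s‖²`): for `χ` a bump of width `≍ Λ` with `|Δχ| ≲ 1/Λ` the right side is a constant INDEPENDENT of `Λ` —
  the scale-uniformity the ledger needs (junk per phase must be geometric in the phase, whatever the frequency scale).
No definitions (the kernel is written out as a `Finset` sum); no statement about the crux.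
[cite: Grafakos2014, Prop. 3.1.2 (5) and Prop. 3.2.7 (3); §3.1.3 (Dirichlet and Fejér kernels)] [problem: turb]
-/

-- `Summit.<Summit>.<Problem>`: single-conjunct summit, the duplicate namespace segment is deliberate.
set_option linter.dupNamespace false

noncomputable section

namespace Summit.AnomalousDissipation.AnomalousDissipation.Theorems.SawtoothPulseCascade.K1Window

open MeasureTheory Set Filter Topology Function Complex
open scoped Real

/-! ## §1 Finite Parseval for trigonometric polynomials on the circle -/

/-- The character integral with two indices: `∫_T e_m · e_{−m'} = [m = m']`. [cite: Grafakos2014, Prop. 3.2.7 (3)] -/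
theorem integral_fourier_mul_fourier_neg (m m' : ℤ) :
    ∫ s : UnitAddCircle, (fourier m s : ℂ) * fourier (-m') s = if m = m' then 1 else 0 := by
  have h : ∀ s : UnitAddCircle, (fourier m s : ℂ) * fourier (-m') s = fourier (m + -m') s := fun s => by
    rw [fourier_add]
  simp_rw [h, Literature.Analysis.FunctionSpaces.Torus.integral_fourier_unitAddCircle]
  by_cases hm : m = m'
  · subst hm; simp
  · rw [if_neg (by omega), if_neg hm]

/-- **Finite Parseval on the circle**: `∫_T ‖Σ_{m∈S} c(m) e_{−m}(s)‖² ds = Σ_{m∈S} ‖c(m)‖²`.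
[cite: Grafakos2014, Prop. 3.2.7 (3)] -/
theorem integral_norm_sq_trigPoly (S : Finset ℤ) (c : ℤ → ℂ) :
    ∫ s : UnitAddCircle, ‖∑ m ∈ S, c m * fourier (-m) s‖ ^ 2 = ∑ m ∈ S, ‖c m‖ ^ 2 := by
  classical
  -- `‖z‖² = re (conj z · z)` and `conj e_{−m} = e_m`
  have hpt : ∀ s : UnitAddCircle, (‖∑ m ∈ S, c m * fourier (-m) s‖ ^ 2 : ℝ) =
      (∑ m ∈ S, ∑ m' ∈ S, starRingEnd ℂ (c m) * c m' * ((fourier m s : ℂ) * fourier (-m') s)).re := by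
    intro s
    have h1 : ((‖∑ m ∈ S, c m * fourier (-m) s‖ ^ 2 : ℝ) : ℂ) =
        starRingEnd ℂ (∑ m ∈ S, c m * fourier (-m) s) * ∑ m ∈ S, c m * fourier (-m) s := by
      rw [Complex.ofReal_pow]; exact (RCLike.conj_mul _).symm
    have h2 : starRingEnd ℂ (∑ m ∈ S, c m * fourier (-m) s) = ∑ m ∈ S, starRingEnd ℂ (c m) * fourier m s := by
      rw [map_sum]
      refine Finset.sum_congr rfl fun m _ => ?_
      rw [map_mul, ← fourier_neg, neg_neg]
    have h3 : ((‖∑ m ∈ S, c m * fourier (-m) s‖ ^ 2 : ℝ) : ℂ) =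
        ∑ m ∈ S, ∑ m' ∈ S, starRingEnd ℂ (c m) * c m' * ((fourier m s : ℂ) * fourier (-m') s) := by
      rw [h1, h2, Finset.sum_mul]
      refine Finset.sum_congr rfl fun m _ => ?_
      rw [Finset.mul_sum]
      refine Finset.sum_congr rfl fun m' _ => ?_
      ring
    have := congrArg Complex.re h3
    rwa [Complex.ofReal_re] at this
  simp_rw [hpt]
  have hint : ∀ m m' : ℤ, Integrable (fun s : UnitAddCircle =>
      starRingEnd ℂ (c m) * c m' * ((fourier m s : ℂ) * fourier (-m') s)) :=
    fun m m' => (continuous_const.mul ((fourier m).continuous.mul (fourier (-m')).continuous)).integrable_of_hasCompactSupport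
      (HasCompactSupport.of_compactSpace _)
  have hFint : Integrable (fun s : UnitAddCircle =>
      ∑ m ∈ S, ∑ m' ∈ S, starRingEnd ℂ (c m) * c m' * ((fourier m s : ℂ) * fourier (-m') s)) :=
    integrable_finsetSum _ fun m _ => integrable_finsetSum _ fun m' _ => hint m m'
  have hre := integral_re hFint
  simp only [RCLike.re_to_complex] at hre
  rw [hre, integral_finsetSum _ fun m _ => integrable_finsetSum _ fun m' _ => hint m m']
  simp_rw [integral_finsetSum _ fun m' _ => hint _ m', integral_const_mul, integral_fourier_mul_fourier_neg]
  rw [Complex.re_sum]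
  refine Finset.sum_congr rfl fun m hm => ?_
  have hsum : ∑ x ∈ S, starRingEnd ℂ (c m) * c x * (if m = x then (1 : ℂ) else 0) = starRingEnd ℂ (c m) * c m := by
    rw [Finset.sum_eq_single_of_mem m hm fun x _ hx => by rw [if_neg (Ne.symm hx), mul_zero], if_pos rfl, mul_one]
  rw [hsum, RCLike.conj_mul]
  norm_cast

/-- Finitely supported coefficient families: the kernel `Σ' m, χ(m) e_{−m}(s)` is the finite sum over any set
containing the support. [folklore] -/
theorem tsum_trigPoly_eq_sum {χ : ℤ → ℂ} {S : Finset ℤ} (hχ : ∀ m, m ∉ S → χ m = 0) (s : UnitAddCircle) :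
    ∑' m : ℤ, χ m * fourier (-m) s = ∑ m ∈ S, χ m * fourier (-m) s :=
  tsum_eq_sum fun m hm => by rw [hχ m hm, zero_mul]

/-- Finite Parseval, `tsum` form: `∫_T ‖Σ' m, χ(m) e_{−m}‖² = Σ' m, ‖χ(m)‖²` for finitely supported `χ`.
[cite: Grafakos2014, Prop. 3.2.7 (3)] -/
theorem integral_norm_sq_tsum_trigPoly {χ : ℤ → ℂ} {S : Finset ℤ} (hχ : ∀ m, m ∉ S → χ m = 0) :
    ∫ s : UnitAddCircle, ‖∑' m : ℤ, χ m * fourier (-m) s‖ ^ 2 = ∑' m : ℤ, ‖χ m‖ ^ 2 := by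
  simp_rw [tsum_trigPoly_eq_sum hχ]
  rw [integral_norm_sq_trigPoly, tsum_eq_sum (s := S) fun m hm => by rw [hχ m hm, norm_zero, zero_pow two_ne_zero]]

/-- The kernel of a finitely supported symbol is continuous. [folklore] -/
theorem continuous_tsum_trigPoly {χ : ℤ → ℂ} {S : Finset ℤ} (hχ : ∀ m, m ∉ S → χ m = 0) :
    Continuous fun s : UnitAddCircle => ∑' m : ℤ, χ m * fourier (-m) s := by
  simp_rw [tsum_trigPoly_eq_sum hχ]
  exact continuous_finsetSum _ fun m _ => continuous_const.mul (fourier (-m)).continuous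

/-! ## §2 The difference identity and the lower bound for `|e₁ − 1|` -/

/-- The forward difference of a symbol supported in `S` is supported in `S ∪ (S − 1)`. [folklore] -/
theorem diff_eq_zero_of_not_mem {χ : ℤ → ℂ} {S : Finset ℤ} (hχ : ∀ m, m ∉ S → χ m = 0) (m : ℤ)
    (hm : m ∉ S ∪ S.image (fun n => n - 1)) : χ (m + 1) - χ m = 0 := by
  rw [Finset.mem_union, not_or] at hm
  have h1 : m + 1 ∉ S := fun h => hm.2 (Finset.mem_image.mpr ⟨m + 1, h, by ring⟩)
  rw [hχ m hm.1, hχ (m + 1) h1, sub_zero]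

/-- **Difference identity**: `(e₁(s) − 1) · Σ' m, χ(m) e_{−m}(s) = Σ' m, (χ(m+1) − χ(m)) e_{−m}(s)` for finitely supported
`χ` — multiplying the kernel by `e₁ − 1` is the forward difference of the symbol (shift `m ↦ m − 1` in the first sum).
[cite: Grafakos2014, §3.1.3] -/
theorem fourier_one_sub_one_mul_tsum_trigPoly {χ : ℤ → ℂ} {S : Finset ℤ} (hχ : ∀ m, m ∉ S → χ m = 0)
    (s : UnitAddCircle) :
    ((fourier 1 s : ℂ) - 1) * ∑' m : ℤ, χ m * fourier (-m) s = ∑' m : ℤ, (χ (m + 1) - χ m) * fourier (-m) s := by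
  have hsum : ∀ (c : ℤ → ℂ) (T : Finset ℤ), (∀ m, m ∉ T → c m = 0) →
      Summable fun m : ℤ => c m * fourier (-m) s := fun c T hc =>
    summable_of_ne_finset_zero (s := T) fun m hm => by rw [hc m hm, zero_mul]
  have hχs := hsum χ S hχ
  have hχ1 : ∀ m, m ∉ S.image (fun n => n - 1) → χ (m + 1) = 0 := fun m hm =>
    hχ (m + 1) fun h => hm (Finset.mem_image.mpr ⟨m + 1, h, by ring⟩)
  have hχ1s := hsum (fun m => χ (m + 1)) _ hχ1
  -- the shifted sum
  have hshift : (fourier 1 s : ℂ) * ∑' m : ℤ, χ m * fourier (-m) s = ∑' m : ℤ, χ (m + 1) * fourier (-m) s := by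
    rw [← tsum_mul_left]
    have h1 : ∀ m : ℤ, (fourier 1 s : ℂ) * (χ m * fourier (-m) s) = χ m * fourier (-(m - 1)) s := fun m => by
      rw [show -(m - 1) = 1 + -m by ring, fourier_add]; ring
    simp_rw [h1]
    exact ((Equiv.subRight (1 : ℤ)).tsum_eq (fun m : ℤ => χ (m + 1) * fourier (-m) s)).symm.trans
      (tsum_congr fun m => by simp [Equiv.subRight_apply]) |>.symm
  rw [sub_mul, one_mul, hshift, ← hχ1s.tsum_sub hχs]
  exact tsum_congr fun m => by ring

/-- **`4‖s‖ ≤ |e₁(s) − 1|` on the circle `ℝ/ℤ`**: with `s = x mod 1`, `|x| ≤ ½`, `|e^{2πix} − 1| = 2|sin πx| ≥ 2·(2/π)·π|x| = 4|x|`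
(Jordan's inequality). [folklore] -/
theorem four_mul_norm_le_norm_fourier_one_sub_one (s : UnitAddCircle) :
    4 * ‖s‖ ≤ ‖(fourier 1 s : ℂ) - 1‖ := by
  -- lift `s` to `x ∈ [-1/2, 1/2)`
  obtain ⟨x, hx, rfl⟩ : ∃ x : ℝ, x ∈ Ico (-(1 / 2 : ℝ)) (-(1 / 2) + 1) ∧ (x : UnitAddCircle) = s := by
    refine ⟨(AddCircle.equivIco 1 (-(1 / 2)) s : ℝ), (AddCircle.equivIco 1 (-(1 / 2)) s).2, ?_⟩
    exact (AddCircle.equivIco 1 (-(1 / 2))).symm_apply_apply s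
  have hxabs : |x| ≤ 1 / 2 := abs_le.mpr ⟨hx.1, by linarith [hx.2]⟩
  have hnorm : ‖(x : UnitAddCircle)‖ = |x| := (AddCircle.norm_coe_eq_abs_iff (1 : ℝ) one_ne_zero).mpr (by simpa using hxabs)
  rw [hnorm, fourier_coe_apply]
  have harg : (2 * ↑π * Complex.I * (1 : ℤ) * ↑x / (1 : ℝ) : ℂ) = Complex.I * ↑(2 * π * x) := by push_cast; ring
  rw [harg, Complex.norm_exp_I_mul_ofReal_sub_one]
  have hsin : 2 * |x| ≤ |Real.sin (2 * π * x / 2)| := by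
    rw [show 2 * π * x / 2 = π * x by ring]
    have hxle : x ≤ 1 / 2 := (le_abs_self x).trans hxabs
    have hxge : -x ≤ 1 / 2 := (neg_le_abs x).trans hxabs
    rcases le_or_gt 0 x with hx0 | hx0
    · rw [abs_of_nonneg hx0]
      have h := Real.mul_le_sin (x := π * x) (by positivity)
        (by nlinarith [Real.pi_pos, mul_le_mul_of_nonneg_left hxle Real.pi_pos.le])
      have : 2 / π * (π * x) = 2 * x := by field_simp
      rw [this] at h
      exact h.trans (le_abs_self _)
    · rw [abs_of_neg hx0]
      have h := Real.mul_le_sin (x := π * (-x)) (by nlinarith [Real.pi_pos])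
        (by nlinarith [Real.pi_pos, mul_le_mul_of_nonneg_left hxge Real.pi_pos.le])
      have : 2 / π * (π * (-x)) = 2 * (-x) := by field_simp
      rw [this] at h
      rw [show π * x = -(π * (-x)) by ring, Real.sin_neg, abs_neg]
      exact (by linarith : 2 * -x ≤ _) |>.trans ((h.trans (le_abs_self _)))
  rw [Real.norm_eq_abs, abs_mul, abs_two]
  linarith


/-! ## §3 The weight `(1 + Λ²‖s‖²)⁻¹` and the scale-uniform `L¹` bound -/

/-- `∫_T (1 + Λ²‖s‖²)⁻¹ ds ≤ π/Λ` (`= (2/Λ)·arctan(Λ/2)` on the fundamental domain `[-½, ½)`). [folklore] -/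
theorem integral_inv_one_add_sq_norm_le {Λ : ℝ} (hΛ : 0 < Λ) :
    ∫ s : UnitAddCircle, (1 + Λ ^ 2 * ‖s‖ ^ 2)⁻¹ ≤ π / Λ := by
  have hT : ∫ s : UnitAddCircle, (1 + Λ ^ 2 * ‖s‖ ^ 2)⁻¹ =
      ∫ x in (-(1 / 2 : ℝ))..(-(1 / 2) + 1), (1 + Λ ^ 2 * ‖(x : UnitAddCircle)‖ ^ 2)⁻¹ :=
    (AddCircle.intervalIntegral_preimage 1 (-(1 / 2)) (fun s : UnitAddCircle => (1 + Λ ^ 2 * ‖s‖ ^ 2)⁻¹)).symm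
  rw [hT]
  have hcongr : ∫ x in (-(1 / 2 : ℝ))..(-(1 / 2) + 1), (1 + Λ ^ 2 * ‖(x : UnitAddCircle)‖ ^ 2)⁻¹ =
      ∫ x in (-(1 / 2 : ℝ))..(-(1 / 2) + 1), (1 + (Λ * x) ^ 2)⁻¹ := by
    refine intervalIntegral.integral_congr fun x hx => ?_
    have hx' : |x| ≤ 1 / 2 := by
      rw [uIcc_of_le (by norm_num)] at hx
      exact abs_le.mpr ⟨by linarith [hx.1], by linarith [hx.2]⟩
    have hn : ‖(x : UnitAddCircle)‖ = |x| :=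
      (AddCircle.norm_coe_eq_abs_iff (1 : ℝ) one_ne_zero).mpr (by simpa using hx')
    simp only [hn, sq_abs, mul_pow]
  rw [hcongr, intervalIntegral.integral_comp_mul_left (fun y : ℝ => (1 + y ^ 2)⁻¹) hΛ.ne', integral_inv_one_add_sq,
    smul_eq_mul]
  have h1 := Real.arctan_lt_pi_div_two (Λ * (-(1 / 2) + 1))
  have h2 := Real.neg_pi_div_two_lt_arctan (Λ * -(1 / 2))
  rw [inv_mul_le_iff₀ hΛ, show Λ * (π / Λ) = π by field_simp]
  linarith

/-- Pointwise: `16‖s‖²‖k_χ(s)‖² ≤ ‖k_{Δχ}(s)‖²` (difference identity and `4‖s‖ ≤ |e₁ − 1|`). [cite: Grafakos2014, §3.1.3] -/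
theorem norm_sq_mul_norm_sq_trigPoly_le {χ : ℤ → ℂ} {S : Finset ℤ} (hχ : ∀ m, m ∉ S → χ m = 0) (s : UnitAddCircle) :
    16 * ‖s‖ ^ 2 * ‖∑' m : ℤ, χ m * fourier (-m) s‖ ^ 2 ≤ ‖∑' m : ℤ, (χ (m + 1) - χ m) * fourier (-m) s‖ ^ 2 := by
  rw [← fourier_one_sub_one_mul_tsum_trigPoly hχ s, norm_mul, mul_pow]
  have h4 := four_mul_norm_le_norm_fourier_one_sub_one s
  have h16 : 16 * ‖s‖ ^ 2 ≤ ‖(fourier 1 s : ℂ) - 1‖ ^ 2 := by nlinarith [norm_nonneg s]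
  exact mul_le_mul_of_nonneg_right h16 (sq_nonneg _)

/-- **Scale-uniform `L¹` bound, AM–GM form**: for every `Λ, t > 0`,
`∫_T |k_χ| ≤ (t/2)·(Σ'‖χ‖² + (Λ²/16)·Σ'‖Δχ‖²) + π/(2tΛ)`. [cite: Grafakos2014, Prop. 3.2.7 (3) and §3.1.3] -/
theorem integral_norm_trigPoly_le_of_pos {χ : ℤ → ℂ} {S : Finset ℤ} (hχ : ∀ m, m ∉ S → χ m = 0) {Λ t : ℝ}
    (hΛ : 0 < Λ) (ht : 0 < t) :
    ∫ s : UnitAddCircle, ‖∑' m : ℤ, χ m * fourier (-m) s‖ ≤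
      t / 2 * (∑' m : ℤ, ‖χ m‖ ^ 2 + Λ ^ 2 / 16 * ∑' m : ℤ, ‖χ (m + 1) - χ m‖ ^ 2) + π / (2 * t * Λ) := by
  classical
  set k : UnitAddCircle → ℂ := fun s => ∑' m : ℤ, χ m * fourier (-m) s with hk
  set kΔ : UnitAddCircle → ℂ := fun s => ∑' m : ℤ, (χ (m + 1) - χ m) * fourier (-m) s with hkΔ
  have hΔ : ∀ m, m ∉ S ∪ S.image (fun n => n - 1) → χ (m + 1) - χ m = 0 := diff_eq_zero_of_not_mem hχ
  have hkc : Continuous k := continuous_tsum_trigPoly hχ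
  have hkΔc : Continuous kΔ := continuous_tsum_trigPoly hΔ
  have hwc : Continuous fun s : UnitAddCircle => 1 + Λ ^ 2 * ‖s‖ ^ 2 := by fun_prop
  have hw1 : ∀ s : UnitAddCircle, 1 ≤ 1 + Λ ^ 2 * ‖s‖ ^ 2 := fun s => by nlinarith [norm_nonneg s]
  have hwic : Continuous fun s : UnitAddCircle => (1 + Λ ^ 2 * ‖s‖ ^ 2)⁻¹ :=
    hwc.inv₀ fun s => (lt_of_lt_of_le one_pos (hw1 s)).ne'
  -- integrability (continuous functions on the compact circle)
  have hI : ∀ {f : UnitAddCircle → ℝ}, Continuous f → Integrable f := fun hf =>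
    hf.integrable_of_hasCompactSupport (HasCompactSupport.of_compactSpace _)
  -- pointwise AM–GM: `|k| ≤ (t/2)|k|²w + 1/(2tw)`
  have hpt : ∀ s : UnitAddCircle, ‖k s‖ ≤
      t / 2 * (‖k s‖ ^ 2 * (1 + Λ ^ 2 * ‖s‖ ^ 2)) + 1 / (2 * t) * (1 + Λ ^ 2 * ‖s‖ ^ 2)⁻¹ := by
    intro s
    set w := 1 + Λ ^ 2 * ‖s‖ ^ 2 with hw
    have hw0 : 0 < w := lt_of_lt_of_le one_pos (hw1 s)
    have hsq := sq_nonneg (t * w * ‖k s‖ - 1)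
    rw [show t / 2 * (‖k s‖ ^ 2 * w) + 1 / (2 * t) * w⁻¹ = (t ^ 2 * w ^ 2 * ‖k s‖ ^ 2 + 1) / (2 * t * w) by
      field_simp]
    rw [le_div_iff₀ (by positivity)]
    nlinarith [norm_nonneg (k s)]
  -- integrate
  have hint_pt : ∫ s : UnitAddCircle, ‖k s‖ ≤ ∫ s : UnitAddCircle,
      (t / 2 * (‖k s‖ ^ 2 * (1 + Λ ^ 2 * ‖s‖ ^ 2)) + 1 / (2 * t) * (1 + Λ ^ 2 * ‖s‖ ^ 2)⁻¹) :=
    integral_mono (hI (continuous_norm.comp hkc)) (hI (by fun_prop)) hpt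
  refine hint_pt.trans ?_
  have hA : Integrable fun s : UnitAddCircle => t / 2 * (‖k s‖ ^ 2 * (1 + Λ ^ 2 * ‖s‖ ^ 2)) := hI (by fun_prop)
  have hB : Integrable fun s : UnitAddCircle => 1 / (2 * t) * (1 + Λ ^ 2 * ‖s‖ ^ 2)⁻¹ := hI (by fun_prop)
  rw [integral_add hA hB, integral_const_mul, integral_const_mul]
  -- the two pieces
  have hP : ∫ s : UnitAddCircle, ‖k s‖ ^ 2 = ∑' m : ℤ, ‖χ m‖ ^ 2 := integral_norm_sq_tsum_trigPoly hχ
  have hPΔ : ∫ s : UnitAddCircle, ‖kΔ s‖ ^ 2 = ∑' m : ℤ, ‖χ (m + 1) - χ m‖ ^ 2 := integral_norm_sq_tsum_trigPoly hΔ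
  have h1 : ∫ s : UnitAddCircle, ‖k s‖ ^ 2 * (1 + Λ ^ 2 * ‖s‖ ^ 2) ≤
      ∑' m : ℤ, ‖χ m‖ ^ 2 + Λ ^ 2 / 16 * ∑' m : ℤ, ‖χ (m + 1) - χ m‖ ^ 2 := by
    have hsplit : ∀ s : UnitAddCircle, ‖k s‖ ^ 2 * (1 + Λ ^ 2 * ‖s‖ ^ 2) =
        ‖k s‖ ^ 2 + Λ ^ 2 / 16 * (16 * ‖s‖ ^ 2 * ‖k s‖ ^ 2) := fun s => by ring
    simp_rw [hsplit]
    rw [integral_add (hI (by fun_prop)) (hI (by fun_prop)), integral_const_mul, hP, ← hPΔ]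
    refine add_le_add le_rfl (mul_le_mul_of_nonneg_left ?_ (by positivity))
    exact integral_mono (hI (by fun_prop)) (hI (by fun_prop)) fun s => norm_sq_mul_norm_sq_trigPoly_le hχ s
  have h2 : ∫ s : UnitAddCircle, (1 + Λ ^ 2 * ‖s‖ ^ 2)⁻¹ ≤ π / Λ := integral_inv_one_add_sq_norm_le hΛ
  have ht2 : 0 ≤ t / 2 := by positivity
  have ht2' : 0 ≤ 1 / (2 * t) := by positivity
  calc t / 2 * ∫ s : UnitAddCircle, ‖k s‖ ^ 2 * (1 + Λ ^ 2 * ‖s‖ ^ 2) ∂volume +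
        1 / (2 * t) * ∫ s : UnitAddCircle, (1 + Λ ^ 2 * ‖s‖ ^ 2)⁻¹ ∂volume
      ≤ t / 2 * (∑' m : ℤ, ‖χ m‖ ^ 2 + Λ ^ 2 / 16 * ∑' m : ℤ, ‖χ (m + 1) - χ m‖ ^ 2) + 1 / (2 * t) * (π / Λ) :=
        add_le_add (mul_le_mul_of_nonneg_left h1 ht2) (mul_le_mul_of_nonneg_left h2 ht2')
    _ = _ := by field_simp

/-- **Scale-uniform `L¹` bound**: `∫_T |k_χ| ≤ √(π/Λ) · √(Σ'‖χ‖² + (Λ²/16)·Σ'‖Δχ‖²)` for every `Λ > 0` (optimise `t`).  For a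
symbol of width `≍ Λ` with `|Δχ| ≲ 1/Λ` the right side does not depend on `Λ`. [cite: Grafakos2014, Prop. 3.2.7 (3) and §3.1.3] -/
theorem integral_norm_trigPoly_le {χ : ℤ → ℂ} {S : Finset ℤ} (hχ : ∀ m, m ∉ S → χ m = 0) {Λ : ℝ} (hΛ : 0 < Λ) :
    ∫ s : UnitAddCircle, ‖∑' m : ℤ, χ m * fourier (-m) s‖ ≤
      Real.sqrt (π / Λ) * Real.sqrt (∑' m : ℤ, ‖χ m‖ ^ 2 + Λ ^ 2 / 16 * ∑' m : ℤ, ‖χ (m + 1) - χ m‖ ^ 2) := by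
  set Q : ℝ := ∑' m : ℤ, ‖χ m‖ ^ 2 + Λ ^ 2 / 16 * ∑' m : ℤ, ‖χ (m + 1) - χ m‖ ^ 2 with hQ
  have hQ0 : 0 ≤ Q := by
    have h1 : 0 ≤ ∑' m : ℤ, ‖χ m‖ ^ 2 := tsum_nonneg fun m => sq_nonneg _
    have h2 : 0 ≤ ∑' m : ℤ, ‖χ (m + 1) - χ m‖ ^ 2 := tsum_nonneg fun m => sq_nonneg _
    positivity
  rcases hQ0.eq_or_lt with hQz | hQp
  · -- `Q = 0`: then `χ = 0` and the kernel vanishes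
    have hχ0 : ∀ m, χ m = 0 := by
      have hs : Summable fun m : ℤ => ‖χ m‖ ^ 2 :=
        summable_of_ne_finset_zero (s := S) fun m hm => by rw [hχ m hm, norm_zero, zero_pow two_ne_zero]
      have h1 : 0 ≤ ∑' m : ℤ, ‖χ m‖ ^ 2 := tsum_nonneg fun m => sq_nonneg _
      have h2 : 0 ≤ ∑' m : ℤ, ‖χ (m + 1) - χ m‖ ^ 2 := tsum_nonneg fun m => sq_nonneg _
      have hz : ∑' m : ℤ, ‖χ m‖ ^ 2 = 0 := by nlinarith [sq_nonneg Λ]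
      intro m
      have hH : HasSum (fun m : ℤ => ‖χ m‖ ^ 2) 0 := hz ▸ hs.hasSum
      have h0 := congrFun ((hasSum_zero_iff_of_nonneg fun n => sq_nonneg _).mp hH) m
      exact norm_eq_zero.mp (pow_eq_zero_iff two_ne_zero |>.mp h0)
    have hk0 : ∀ s : UnitAddCircle, ∑' m : ℤ, χ m * fourier (-m) s = 0 := fun s => by
      simp [hχ0]
    simp_rw [hk0, norm_zero, integral_zero]
    positivity
  · have h := integral_norm_trigPoly_le_of_pos hχ hΛ (t := Real.sqrt (π / Λ) / Real.sqrt Q) (by positivity)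
    refine h.trans (le_of_eq ?_)
    rw [← hQ]
    have hsQ : 0 < Real.sqrt Q := Real.sqrt_pos.mpr hQp
    have hsP : 0 < Real.sqrt (π / Λ) := Real.sqrt_pos.mpr (by positivity)
    have eQ : Q = Real.sqrt Q ^ 2 := (Real.sq_sqrt hQp.le).symm
    have eP : π / Λ = Real.sqrt (π / Λ) ^ 2 := (Real.sq_sqrt (by positivity)).symm
    have : π / (2 * (Real.sqrt (π / Λ) / Real.sqrt Q) * Λ) = Real.sqrt (π / Λ) * Real.sqrt Q / 2 := by
      rw [show π / (2 * (Real.sqrt (π / Λ) / Real.sqrt Q) * Λ) = (π / Λ) * Real.sqrt Q / (2 * Real.sqrt (π / Λ)) by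
        field_simp]
      nth_rewrite 1 [eP]
      field_simp
    rw [this]
    nth_rewrite 2 [eQ]
    field_simp
    ring


/-! ## §4 Moments: `‖s‖·|k_χ| ≤ ¼|k_{Δχ}|`, so every absolute moment is an `L¹` norm of a differenced symbol -/

/-- Pointwise: `4‖s‖·|k_χ(s)| ≤ |k_{Δχ}(s)|`. [cite: Grafakos2014, §3.1.3] -/
theorem norm_mul_norm_trigPoly_le {χ : ℤ → ℂ} {S : Finset ℤ} (hχ : ∀ m, m ∉ S → χ m = 0) (s : UnitAddCircle) :
    4 * ‖s‖ * ‖∑' m : ℤ, χ m * fourier (-m) s‖ ≤ ‖∑' m : ℤ, (χ (m + 1) - χ m) * fourier (-m) s‖ := by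
  rw [← fourier_one_sub_one_mul_tsum_trigPoly hχ s, norm_mul]
  exact mul_le_mul_of_nonneg_right (four_mul_norm_le_norm_fourier_one_sub_one s) (norm_nonneg _)

/-- **First absolute moment**: `∫_T ‖s‖·|k_χ(s)| ds ≤ ¼ ∫_T |k_{Δχ}|` — combine with `integral_norm_trigPoly_le` for `Δχ`
(supported in `S ∪ (S−1)`, `diff_eq_zero_of_not_mem`): for a bump of width `≍ Λ` this is `O(1/Λ)`.
[cite: Grafakos2014, §3.1.3] -/
theorem integral_norm_mul_norm_trigPoly_le {χ : ℤ → ℂ} {S : Finset ℤ} (hχ : ∀ m, m ∉ S → χ m = 0) :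
    ∫ s : UnitAddCircle, ‖s‖ * ‖∑' m : ℤ, χ m * fourier (-m) s‖ ≤
      1 / 4 * ∫ s : UnitAddCircle, ‖∑' m : ℤ, (χ (m + 1) - χ m) * fourier (-m) s‖ := by
  have hΔ : ∀ m, m ∉ S ∪ S.image (fun n => n - 1) → χ (m + 1) - χ m = 0 := diff_eq_zero_of_not_mem hχ
  have hI : ∀ {f : UnitAddCircle → ℝ}, Continuous f → Integrable f := fun hf =>
    hf.integrable_of_hasCompactSupport (HasCompactSupport.of_compactSpace _)
  rw [← integral_const_mul]
  refine integral_mono (hI (continuous_norm.mul (continuous_norm.comp (continuous_tsum_trigPoly hχ))))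
    (hI (continuous_const.mul (continuous_norm.comp (continuous_tsum_trigPoly hΔ)))) fun s => ?_
  have h := norm_mul_norm_trigPoly_le hχ s
  simp only
  linarith

/-- **Tail beyond `‖s‖ ≥ δ`** (Chebyshev with the first moment): for `0 < δ` and any set `E` of points with `δ ≤ ‖s‖`,
`∫_E |k_χ| ≤ (1/(4δ)) ∫_T |k_{Δχ}|`. [cite: Grafakos2014, §3.1.3] -/
theorem setIntegral_norm_trigPoly_le {χ : ℤ → ℂ} {S : Finset ℤ} (hχ : ∀ m, m ∉ S → χ m = 0) {δ : ℝ} (hδ : 0 < δ)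
    {E : Set UnitAddCircle} (hEm : MeasurableSet E) (hE : ∀ s ∈ E, δ ≤ ‖s‖) :
    ∫ s in E, ‖∑' m : ℤ, χ m * fourier (-m) s‖ ≤
      1 / (4 * δ) * ∫ s : UnitAddCircle, ‖∑' m : ℤ, (χ (m + 1) - χ m) * fourier (-m) s‖ := by
  have hΔ : ∀ m, m ∉ S ∪ S.image (fun n => n - 1) → χ (m + 1) - χ m = 0 := diff_eq_zero_of_not_mem hχ
  have hI : ∀ {f : UnitAddCircle → ℝ}, Continuous f → Integrable f := fun hf =>
    hf.integrable_of_hasCompactSupport (HasCompactSupport.of_compactSpace _)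
  have hkc := continuous_norm.comp (continuous_tsum_trigPoly hχ)
  -- on `E`: `|k| ≤ (1/δ)‖s‖|k|`
  have h1 : ∫ s in E, ‖∑' m : ℤ, χ m * fourier (-m) s‖ ≤
      ∫ s in E, 1 / δ * (‖s‖ * ‖∑' m : ℤ, χ m * fourier (-m) s‖) := by
    refine setIntegral_mono_on (hI hkc).integrableOn ((hI (by fun_prop)).integrableOn) hEm fun s hs => ?_
    have hk0 := norm_nonneg (∑' m : ℤ, χ m * fourier (-m) s)
    rw [← mul_assoc]
    have : 1 ≤ 1 / δ * ‖s‖ := by rw [one_div_mul_eq_div, le_div_iff₀ hδ, one_mul]; exact hE s hs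
    nlinarith
  refine h1.trans ?_
  have h2 : ∫ s in E, 1 / δ * (‖s‖ * ‖∑' m : ℤ, χ m * fourier (-m) s‖) ≤
      ∫ s : UnitAddCircle, 1 / δ * (‖s‖ * ‖∑' m : ℤ, χ m * fourier (-m) s‖) :=
    setIntegral_le_integral (hI (by fun_prop)) (Eventually.of_forall fun s => by positivity)
  refine h2.trans ?_
  rw [integral_const_mul]
  have h3 := integral_norm_mul_norm_trigPoly_le hχ
  have hδ' : 0 ≤ 1 / δ := by positivity
  calc 1 / δ * ∫ s : UnitAddCircle, ‖s‖ * ‖∑' m : ℤ, χ m * fourier (-m) s‖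
      ≤ 1 / δ * (1 / 4 * ∫ s : UnitAddCircle, ‖∑' m : ℤ, (χ (m + 1) - χ m) * fourier (-m) s‖) :=
        mul_le_mul_of_nonneg_left h3 hδ'
    _ = _ := by rw [← mul_assoc]; congr 1; field_simp

end Summit.AnomalousDissipation.AnomalousDissipation.Theorems.SawtoothPulseCascade.K1Window
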